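import Literature.NumberTheory.LFunctions.KMVMomentsToHalfEdge
import Mathlib.NumberTheory.EulerProduct.Basic
import Mathlib.Analysis.Normed.Group.Tannery
import Mathlib.Analysis.PSeries
import HarnessLib

/-!
# The model-(A) order-0 Eisenstein row on KMV profiles is, at leading order, the evaluation
# functional `Φ ↦ c·Φ(1)` with `c > 0` (support statement `ModelARowIsEvaluation` of the §D fam
# card `siegel-point-annihilation`, redraw r1 — PROVED)

Topic `Literature/NumberTheory/LFunctions` (namespace `Literature.NumberTheory.LFunctions.KMV2000`,
the grouping sub-namespace of the Kowalski–Michel–VanderKam 2000 typings; the objects are the tree's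
`KMV2000.psi` = `ψ(m) = Π_{p∣m}(1 + 1/p)` (KMV (8), `KMVHighDerivativeNonvanishing.lean`) and the
Möbius mollifier weights `μ(m) ψ(m)⁻¹` of KMV (9) (`KMV2000.mollifierP`)). Cell `landau-siegel`
(LANDAU–SIEGEL PROGRAMME, rung F-S3), §D typer for edge fam = the ½-proportion edge; card
`siegel-point-annihilation` REDRAW r1 (ls-knife-fam-idea-1 g2, 2026-08-27T02:09Z; draft
`knife/fam/idea-1/CARD-siegel-point-annihilation-r1.md` sha16 8e71c6463e6791e7; Sketch
`Sketch-siegel-point-annihilation-r1.lean` sha16 8375c7b3ef27cd9b, end of file: «Informal support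
statement (leading-order identification, NOT proved here) `ModelARowIsEvaluation` … Typing deferred
to typer-3»). PROOFS only — every statement below is a kernel theorem about the tree's REAL
definitions; no named fact (`def … : Prop`) and no new definition is introduced.

## What the card says (r1 «What it needs», P4; Sketch r1, end of file)

«`ModelARowIsEvaluation` : for fixed continuous `Φ` on `[0,1]` and the KMV weights,
`Σ_{m ≤ M, m sqfree} μ(m) ψ(m)⁻¹ Φ(log(M/m)/log M) m⁻² → Φ(1) · Π_p (1 − 1/(p² ψ(p)))`
as `M → ∞` (absolute convergence of `Σ m⁻²`), so that the model-(A) order-0 Eisenstein row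
`ζ(2) Σ_m x_m m⁻²` is, at leading order, the evaluation functional `P ↦ c·P(1)` on KMV profiles.»
(Under model (A) — `χ_D(p) = −1` for all `p ≤ M·Y` — one has `r_K = 1 ∗ χ_D = 𝟙_□`, whence the
order-0 Eisenstein pairing row of the card is `w·x = ζ(2) Σ_m x_m m⁻²`, card r1 «NEW IN r1»; that
derivation is the card's and is NOT typed here — this file is the elementary limit statement.)

## What is PROVED (all `M : ℝ → ∞`, sums over `1 ≤ m ≤ ⌊M⌋` as in the tree's `KMV2000.mollifierP`)

* `summable_moebius_mul_inv_psi_div_sq` (+ `abs_…_le`, `summable_abs_…`): the weights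
  `a(m) = μ(m) ψ(m)⁻¹ m⁻²` satisfy `|a(m)| ≤ m⁻²`, hence are absolutely summable.
* `tendsto_sum_moebius_mul_inv_psi_div_sq_mul` — DOMINATED CONVERGENCE (Tannery): for `Φ`
  continuous on `[0,1]`, `Σ_{m ≤ M} a(m) Φ(log(M/m)/log M) → Φ(1) · Σ_{m ≥ 1} a(m)` (each summand
  tends to `a(m)Φ(1)` since `log(M/m)/log M = 1 − log m/log M → 1`; domination by `sup|Φ|·m⁻²`;
  the arguments stay in `[0,1]`).
* `tsum_moebius_mul_inv_psi_div_sq_eq_tprod` / `hasProd_one_sub_inv_sq_mul_psi` — EULER PRODUCT: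
  `Σ_{m ≥ 1} a(m) = Π_p (1 − 1/(p² ψ(p)))` (the weight is the multiplicative arithmetic function
  `μ · Π_{p∣m}(p²(1+1/p))⁻¹`, `moebius_mul_inv_psi_div_sq_eq_pmul`; local factor
  `tsum_weight_prime_pow`; Mathlib `IsMultiplicative.eulerProduct_hasProd`), with
  `one_sub_inv_sq_mul_psi : 1 − 1/(p²ψ(p)) = 1 − 1/(p(p+1))`, `psi_prime`, `psi_one`.
* `modelARowIsEvaluation` — the card's display verbatim:
  `Σ_{m ≤ M} μ(m) ψ(m)⁻¹ m⁻² Φ(log(M/m)/log M) → Φ(1) · Π_p (1 − 1/(p² ψ(p)))`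
  (`sum_moebius_weight_filter_squarefree`: the restriction to squarefree `m` is automatic).
* `half_le_tsum_moebius_mul_inv_psi_div_sq`, `tprod_one_sub_inv_sq_mul_psi_pos` — the constant is
  POSITIVE, indeed `≥ 1/2` (Weierstrass' inequality `Π(1 − x_p) ≥ 1 − Σ x_p` on the partial products
  and the telescoping bound `Σ_p 1/(p(p+1)) ≤ Σ_{n ≥ 2} 1/(n(n+1)) = 1/2`): the leading-order row is
  `c·Φ(1)` with `c = ζ(2)·Π_p(1 − 1/(p(p+1))) ≠ 0`, so under model (A) the Siegel-point constraint
  on KMV profiles is exactly `P(1) = 0` — the hypothesis of the constrained envelope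
  `KMV2000.ratio_one_le_of_eval_one_eq_zero` (`KMVSiegelPointConstrainedEnvelope.lean`, p487582).

WHAT THIS IS NOT: no statement about the rate of convergence (the card's «leading order» is the
bare limit here), none about the rows in the generic world (the card's toy j264897), nothing about
the card's cruxes K1–K3; no claim about the ½-proportion edge.
«The programme SEARCHES and TYPES; no claim about Landau–Siegel zeros, Theorems 1–2 of
arXiv:2211.02515 or a repaired Margin232 until a kernel theorem says so.»

## References

* [KowalskiMichelVanderKam2000] E. Kowalski, P. Michel, J. VanderKam, *Non-vanishing of high
  derivatives of automorphic L-functions at the center of the critical strip*, J. reine angew.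
  Math. 526 (2000), §2 (8)–(9) p. 6 (`ψ(m) = Π_{p∣m}(1+1/p)`, mollifier weights
  `μ(m)ψ(m)⁻¹ m^{−1/2} P(log(M/m)/log M)`) — held `paper:doi-10-1515-crll-2000-074`; typed in the
  tree as `KMV2000.psi`, `KMV2000.mollifierP`.
* Mathlib: `tendsto_tsum_of_dominated_convergence` (Tannery), `ArithmeticFunction.IsMultiplicative.
  eulerProduct_hasProd`, `Nat.prod_primeFactors_of_squarefree`.
-/

noncomputable section

open Filter Topology Finset ArithmeticFunction Nat

open scoped ArithmeticFunction.Moebius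

namespace Literature.NumberTheory.LFunctions.KMV2000

/-! ### The weights `a(m) = μ(m) ψ(m)⁻¹ m⁻²` are absolutely summable -/

/-- `|μ(m) ψ(m)⁻¹ / m²| ≤ 1/m²` (`|μ| ≤ 1`, `ψ ≥ 1`).
[cite: KowalskiMichelVanderKam2000, (8)–(9) (the weights `μ(m) ψ(m)⁻¹`)] -/
theorem abs_moebius_mul_inv_psi_div_sq_le (m : ℕ) :
    |(μ m : ℝ) * (psi m)⁻¹ / (m : ℝ) ^ 2| ≤ 1 / (m : ℝ) ^ 2 := by
  rw [abs_div, abs_mul, abs_of_nonneg (by positivity : (0:ℝ) ≤ (m : ℝ) ^ 2)]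
  have hμ : |(μ m : ℝ)| ≤ 1 := by exact_mod_cast abs_moebius_le_one
  have hψ1 := one_le_psi m
  have hψ : |(psi m)⁻¹| ≤ 1 := by
    rw [abs_of_nonneg (inv_nonneg.mpr (by linarith))]
    exact inv_le_one_of_one_le₀ hψ1
  have h : |(μ m : ℝ)| * |(psi m)⁻¹| ≤ 1 :=
    by nlinarith [abs_nonneg (μ m : ℝ), abs_nonneg ((psi m)⁻¹)]
  exact div_le_div_of_nonneg_right (by linarith) (by positivity)

/-- `Σ_m |μ(m) ψ(m)⁻¹ m⁻²| < ∞`. [cite: KowalskiMichelVanderKam2000, (8)–(9)] -/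
theorem summable_abs_moebius_mul_inv_psi_div_sq :
    Summable fun m : ℕ => |(μ m : ℝ) * (psi m)⁻¹ / (m : ℝ) ^ 2| :=
  (Real.summable_one_div_nat_pow.mpr one_lt_two).of_nonneg_of_le (fun _ => abs_nonneg _)
    abs_moebius_mul_inv_psi_div_sq_le

/-- `Σ_m μ(m) ψ(m)⁻¹ m⁻²` converges (absolutely). [cite: KowalskiMichelVanderKam2000, (8)–(9)] -/
theorem summable_moebius_mul_inv_psi_div_sq :
    Summable fun m : ℕ => (μ m : ℝ) * (psi m)⁻¹ / (m : ℝ) ^ 2 :=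
  summable_abs_moebius_mul_inv_psi_div_sq.of_abs

/-! ### Dominated convergence: the row tends to `Φ(1) · Σ_m μ(m) ψ(m)⁻¹ m⁻²` -/

/-- For fixed `k ≥ 1`: `log(M/k)/log M → 1` as `M → ∞`. [folklore] -/
private theorem tendsto_log_div_log (k : ℕ) (hk : 0 < k) :
    Tendsto (fun M : ℝ => Real.log (M / k) / Real.log M) atTop (𝓝 1) := by
  have hk0 : (k : ℝ) ≠ 0 := Nat.cast_ne_zero.mpr hk.ne'
  have h1 : Tendsto (fun M : ℝ => 1 - Real.log k / Real.log M) atTop (𝓝 (1 - 0)) :=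
    tendsto_const_nhds.sub (tendsto_const_nhds.div_atTop Real.tendsto_log_atTop)
  rw [sub_zero] at h1
  refine h1.congr' ?_
  filter_upwards [eventually_gt_atTop (1 : ℝ)] with M hM
  have hM0 : M ≠ 0 := by positivity
  have hlog : Real.log M ≠ 0 := (Real.log_pos hM).ne'
  rw [Real.log_div hM0 hk0]
  field_simp

/-- For `1 ≤ k ≤ ⌊M⌋`: `log(M/k)/log M ∈ [0,1]` (with Lean's `x/0 = 0` at `M = 1`). [folklore] -/
private theorem log_div_log_mem_Icc {M : ℝ} {k : ℕ} (hk : k ∈ Icc 1 ⌊M⌋₊) :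
    Real.log (M / k) / Real.log M ∈ Set.Icc (0 : ℝ) 1 := by
  rw [Finset.mem_Icc] at hk
  have hk1 : (1 : ℝ) ≤ k := by exact_mod_cast hk.1
  have hM1 : 1 ≤ M := by
    have : 0 < ⌊M⌋₊ := lt_of_lt_of_le Nat.one_pos (le_trans hk.1 hk.2)
    exact_mod_cast (Nat.floor_pos.mp this)
  have hkM : (k : ℝ) ≤ M := le_trans (by exact_mod_cast hk.2) (Nat.floor_le (by linarith))
  have hk0 : (0 : ℝ) < k := by linarith
  have hMk : 1 ≤ M / k := by rw [le_div_iff₀ hk0]; linarith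
  have hlogM : 0 ≤ Real.log M := Real.log_nonneg hM1
  have hnum : 0 ≤ Real.log (M / k) := Real.log_nonneg hMk
  have hle : Real.log (M / k) ≤ Real.log M :=
    Real.log_le_log (by positivity) (div_le_self (by linarith) hk1)
  exact ⟨div_nonneg hnum hlogM, div_le_one_of_le₀ hle hlogM⟩

/-- **`ModelARowIsEvaluation` (card `siegel-point-annihilation` r1, support statement; PROVED).**
For `Φ` continuous on `[0,1]`,
`Σ_{m ≤ M} μ(m) ψ(m)⁻¹ m⁻² Φ(log(M/m)/log M) → Φ(1) · Σ_{m ≥ 1} μ(m) ψ(m)⁻¹ m⁻²` as `M → ∞`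
(dominated convergence: each summand tends to `μ(m)ψ(m)⁻¹m⁻² Φ(1)`, dominated by `sup|Φ|·m⁻²`).
With the KMV weights `x_m = μ(m) ψ(m)⁻¹ P(log(M/m)/log M)` (KMV (9)) and `Φ = P`, this is the
card's «the model-(A) order-0 Eisenstein row `ζ(2) Σ_m x_m m⁻²` is, at leading order, the
evaluation functional `P ↦ c·P(1)`». [cite: KowalskiMichelVanderKam2000, (8)–(9) (the mollifier
weights; the limit statement is the card's, elementary)] -/
theorem tendsto_sum_moebius_mul_inv_psi_div_sq_mul (Φ : ℝ → ℝ)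
    (hΦ : ContinuousOn Φ (Set.Icc 0 1)) :
    Tendsto (fun M : ℝ => ∑ m ∈ Icc 1 ⌊M⌋₊,
        (μ m : ℝ) * (psi m)⁻¹ / (m : ℝ) ^ 2 * Φ (Real.log (M / m) / Real.log M))
      atTop (𝓝 (Φ 1 * ∑' m : ℕ, (μ m : ℝ) * (psi m)⁻¹ / (m : ℝ) ^ 2)) := by
  obtain ⟨C, hC⟩ := isCompact_Icc.exists_bound_of_continuousOn hΦ
  have hC0 : 0 ≤ C := le_trans (norm_nonneg _) (hC 0 ⟨le_rfl, zero_le_one⟩)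
  -- the finite sums as `tsum`s of an indicator-type family
  set f : ℝ → ℕ → ℝ := fun M k => if k ∈ Icc 1 ⌊M⌋₊ then
      (μ k : ℝ) * (psi k)⁻¹ / (k : ℝ) ^ 2 * Φ (Real.log (M / k) / Real.log M) else 0 with hf
  have hsum_eq : ∀ M : ℝ, ∑ m ∈ Icc 1 ⌊M⌋₊,
      (μ m : ℝ) * (psi m)⁻¹ / (m : ℝ) ^ 2 * Φ (Real.log (M / m) / Real.log M) = ∑' k, f M k := by
    intro M
    rw [tsum_eq_sum (s := Icc 1 ⌊M⌋₊) (fun k hk => by simp only [hf, if_neg hk])]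
    exact Finset.sum_congr rfl (fun k hk => by simp only [hf, if_pos hk])
  have hlim_eq : Φ 1 * ∑' m : ℕ, (μ m : ℝ) * (psi m)⁻¹ / (m : ℝ) ^ 2 =
      ∑' k : ℕ, (μ k : ℝ) * (psi k)⁻¹ / (k : ℝ) ^ 2 * Φ 1 := by
    rw [tsum_mul_right, mul_comm]
  simp_rw [hsum_eq]
  rw [hlim_eq]
  refine tendsto_tsum_of_dominated_convergence (bound := fun k => C * (1 / (k : ℝ) ^ 2)) ?_ ?_ ?_
  · exact (Real.summable_one_div_nat_pow.mpr one_lt_two).mul_left C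
  · intro k
    rcases Nat.eq_zero_or_pos k with rfl | hk
    · have h0 : ∀ M, f M 0 = 0 := fun M => by
        simp only [hf, Finset.mem_Icc, nonpos_iff_eq_zero, one_ne_zero, false_and, if_false]
      simp only [h0, Nat.cast_zero, ArithmeticFunction.map_zero, Int.cast_zero, zero_mul,
        zero_div]
      exact tendsto_const_nhds
    · have hev : (fun M => (μ k : ℝ) * (psi k)⁻¹ / (k : ℝ) ^ 2 *
          Φ (Real.log (M / k) / Real.log M)) =ᶠ[atTop] fun M => f M k := by
        filter_upwards [eventually_ge_atTop (k : ℝ)] with M hM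
        have hmem : k ∈ Icc 1 ⌊M⌋₊ := Finset.mem_Icc.mpr ⟨hk, Nat.le_floor hM⟩
        simp only [hf, if_pos hmem]
      refine Tendsto.congr' hev ?_
      refine Tendsto.const_mul _ ?_
      have harg := tendsto_log_div_log k hk
      have hmem : ∀ᶠ M : ℝ in atTop, Real.log (M / k) / Real.log M ∈ Set.Icc (0 : ℝ) 1 := by
        filter_upwards [eventually_ge_atTop (k : ℝ)] with M hM
        exact log_div_log_mem_Icc (Finset.mem_Icc.mpr ⟨hk, Nat.le_floor hM⟩)
      exact (hΦ 1 ⟨zero_le_one, le_rfl⟩).tendsto.comp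
        (tendsto_nhdsWithin_iff.mpr ⟨harg, hmem⟩)
  · refine Eventually.of_forall (fun M k => ?_)
    by_cases hk : k ∈ Icc 1 ⌊M⌋₊
    · simp only [hf, if_pos hk, Real.norm_eq_abs, abs_mul]
      have h1 := abs_moebius_mul_inv_psi_div_sq_le k
      have h2 : |Φ (Real.log (M / k) / Real.log M)| ≤ C := by
        have := hC _ (log_div_log_mem_Icc hk)
        rwa [Real.norm_eq_abs] at this
      calc |(μ k : ℝ) * (psi k)⁻¹ / (k : ℝ) ^ 2| * |Φ (Real.log (M / k) / Real.log M)|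
          ≤ (1 / (k : ℝ) ^ 2) * C :=
            mul_le_mul h1 h2 (abs_nonneg _) (by positivity)
        _ = C * (1 / (k : ℝ) ^ 2) := mul_comm _ _
    · simp only [hf, if_neg hk, norm_zero]
      positivity

/-! ### The Euler product `Σ_m μ(m) ψ(m)⁻¹ m⁻² = Π_p (1 − 1/(p² ψ(p)))` -/

/-- `ψ(p) = 1 + 1/p` at a prime. [cite: KowalskiMichelVanderKam2000, (8)] -/
theorem psi_prime {p : ℕ} (hp : p.Prime) : psi p = 1 + (p : ℝ)⁻¹ := by
  unfold psi
  rw [hp.primeFactors, Finset.prod_singleton]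

/-- The weight `μ(m) ψ(m)⁻¹ m⁻²` is the multiplicative arithmetic function
`μ · Π_{p ∣ m} (p²(1 + 1/p))⁻¹` (both vanish off the squarefree `m`; on squarefree `m`,
`m² ψ(m) = Π_{p∣m} p²(1+1/p)`). [cite: KowalskiMichelVanderKam2000, (8)–(9)] -/
theorem moebius_mul_inv_psi_div_sq_eq_pmul (m : ℕ) :
    (μ m : ℝ) * (psi m)⁻¹ / (m : ℝ) ^ 2 =
      ((μ : ArithmeticFunction ℝ).pmul
        (prodPrimeFactors fun p => ((p : ℝ) ^ 2 * (1 + (p : ℝ)⁻¹))⁻¹)) m := by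
  rw [pmul_apply, intCoe_apply]
  rcases eq_or_ne m 0 with rfl | hm
  · simp
  rw [prodPrimeFactors_apply hm]
  by_cases hsq : Squarefree m
  · have hm2 : ((m : ℝ)) ^ 2 = ∏ p ∈ m.primeFactors, (p : ℝ) ^ 2 := by
      rw [Finset.prod_pow, ← Nat.cast_prod, Nat.prod_primeFactors_of_squarefree hsq]
    unfold psi
    rw [hm2, ← Finset.prod_inv_distrib, div_eq_mul_inv, ← Finset.prod_inv_distrib, mul_assoc,
      ← Finset.prod_mul_distrib]
    congr 1
    refine Finset.prod_congr rfl (fun p _ => ?_)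
    rw [mul_inv, mul_comm]
  · have hμ : μ m = 0 := ArithmeticFunction.moebius_eq_zero_of_not_squarefree hsq
    simp [hμ]

/-- The arithmetic function `μ · Π_{p ∣ ·} (p²(1 + 1/p))⁻¹` is multiplicative. [folklore] -/
private theorem isMultiplicative_weight :
    IsMultiplicative ((μ : ArithmeticFunction ℝ).pmul
        (prodPrimeFactors fun p => ((p : ℝ) ^ 2 * (1 + (p : ℝ)⁻¹))⁻¹)) :=
  isMultiplicative_moebius.intCast.pmul (IsMultiplicative.prodPrimeFactors _)

/-- `ψ(1) = 1`. [cite: KowalskiMichelVanderKam2000, (8)] -/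
theorem psi_one : psi 1 = 1 := by
  unfold psi
  rw [Nat.primeFactors_one, Finset.prod_empty]

/-- The local Euler factor: `Σ_e μ(p^e) ψ(p^e)⁻¹ p^{−2e} = 1 − 1/(p² ψ(p))`.
[cite: KowalskiMichelVanderKam2000, (8)–(9)] -/
theorem tsum_weight_prime_pow {p : ℕ} (hp : p.Prime) :
    ∑' e : ℕ, (μ (p ^ e) : ℝ) * (psi (p ^ e))⁻¹ / ((p ^ e : ℕ) : ℝ) ^ 2 =
      1 - ((p : ℝ) ^ 2 * psi p)⁻¹ := by
  have hzero : ∀ e ∉ Finset.range 2,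
      (μ (p ^ e) : ℝ) * (psi (p ^ e))⁻¹ / ((p ^ e : ℕ) : ℝ) ^ 2 = 0 := by
    intro e he
    rw [Finset.mem_range, not_lt] at he
    have hne : e ≠ 1 := by omega
    have he0 : e ≠ 0 := by omega
    rw [ArithmeticFunction.moebius_apply_prime_pow hp he0, if_neg hne]
    simp
  rw [tsum_eq_sum hzero, Finset.sum_range_succ, Finset.sum_range_one]
  simp only [pow_zero, pow_one, ArithmeticFunction.moebius_apply_one,
    ArithmeticFunction.moebius_apply_prime hp, psi_one, Int.cast_one, Int.cast_neg, Nat.cast_one,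
    one_pow, inv_one, mul_one, div_one]
  rw [mul_inv]
  ring

/-- **Euler product of the model-(A) row constant**:
`Σ_{m ≥ 1} μ(m) ψ(m)⁻¹ m⁻² = Π_p (1 − 1/(p² ψ(p)))` (absolutely convergent multiplicative series).
Card `siegel-point-annihilation` r1, `ModelARowIsEvaluation` («`→ Φ(1) · Π_p (1 − 1/(p² ψ(p)))`»).
[cite: KowalskiMichelVanderKam2000, (8)–(9) (the weights); Euler product folklore] -/
theorem tsum_moebius_mul_inv_psi_div_sq_eq_tprod :
    ∑' m : ℕ, (μ m : ℝ) * (psi m)⁻¹ / (m : ℝ) ^ 2 =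
      ∏' p : Nat.Primes, (1 - (((p : ℕ) : ℝ) ^ 2 * psi p)⁻¹) := by
  have hsum : Summable (fun m => ‖((μ : ArithmeticFunction ℝ).pmul
      (prodPrimeFactors fun p => ((p : ℝ) ^ 2 * (1 + (p : ℝ)⁻¹))⁻¹)) m‖) := by
    simp_rw [Real.norm_eq_abs, ← moebius_mul_inv_psi_div_sq_eq_pmul]
    exact summable_abs_moebius_mul_inv_psi_div_sq
  have hE := isMultiplicative_weight.eulerProduct_tprod hsum
  simp_rw [← moebius_mul_inv_psi_div_sq_eq_pmul] at hE
  rw [← hE]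
  refine tprod_congr (fun p => ?_)
  exact tsum_weight_prime_pow p.prop

/-- The Euler factor in closed form: `1 − 1/(p² ψ(p)) = 1 − 1/(p(p+1))` at a prime `p`.
[cite: KowalskiMichelVanderKam2000, (8)] -/
theorem one_sub_inv_sq_mul_psi {p : ℕ} (hp : p.Prime) :
    1 - ((p : ℝ) ^ 2 * psi p)⁻¹ = 1 - ((p : ℝ) * (p + 1))⁻¹ := by
  rw [psi_prime hp]
  have hp0 : (p : ℝ) ≠ 0 := Nat.cast_ne_zero.mpr hp.ne_zero
  congr 1
  rw [inv_inj]
  field_simp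

/-- **`ModelARowIsEvaluation`, Euler-product form (card `siegel-point-annihilation` r1; PROVED).**
For `Φ` continuous on `[0,1]`:
`Σ_{m ≤ M} μ(m) ψ(m)⁻¹ m⁻² Φ(log(M/m)/log M) → Φ(1) · Π_p (1 − 1/(p² ψ(p)))` as `M → ∞` — the
card's display verbatim («`Σ_{m sqfree ≤ M} μ(m)ψ(m)⁻¹Φ(log(M/m)/log M)m⁻² →
Φ(1)·Π_p(1 − 1/(p²ψ(p)))` — dominated convergence»; the restriction to squarefree `m` is automatic,
`μ = 0` elsewhere, `sum_moebius_weight_filter_squarefree`).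
[cite: KowalskiMichelVanderKam2000, (8)–(9) (the mollifier weights; the limit statement is the
card's, elementary)] -/
theorem modelARowIsEvaluation (Φ : ℝ → ℝ) (hΦ : ContinuousOn Φ (Set.Icc 0 1)) :
    Tendsto (fun M : ℝ => ∑ m ∈ Icc 1 ⌊M⌋₊,
        (μ m : ℝ) * (psi m)⁻¹ / (m : ℝ) ^ 2 * Φ (Real.log (M / m) / Real.log M))
      atTop (𝓝 (Φ 1 * ∏' p : Nat.Primes, (1 - (((p : ℕ) : ℝ) ^ 2 * psi p)⁻¹))) := by
  rw [← tsum_moebius_mul_inv_psi_div_sq_eq_tprod]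
  exact tendsto_sum_moebius_mul_inv_psi_div_sq_mul Φ hΦ

/-- The squarefree restriction in the card's display is automatic (`μ(m) = 0` for non-squarefree
`m`). [cite: KowalskiMichelVanderKam2000, (9)] -/
theorem sum_moebius_weight_filter_squarefree (M : ℝ) (g : ℕ → ℝ) :
    ∑ m ∈ (Icc 1 ⌊M⌋₊).filter Squarefree, (μ m : ℝ) * g m =
      ∑ m ∈ Icc 1 ⌊M⌋₊, (μ m : ℝ) * g m := by
  rw [Finset.sum_filter]
  refine Finset.sum_congr rfl (fun m _ => ?_)
  split_ifs with h
  · rfl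
  · rw [ArithmeticFunction.moebius_eq_zero_of_not_squarefree h]
    simp

/-! ### The constant is positive: `Π_p (1 − 1/(p(p+1))) ≥ 1/2` (so the row is `c·Φ(1)`, `c ≠ 0`) -/

/-- Weierstrass' product inequality: `1 − Σ x_i ≤ Π (1 − x_i)` for `0 ≤ x_i ≤ 1`. [folklore] -/
private theorem one_sub_sum_le_prod_one_sub {ι : Type*} [DecidableEq ι] (s : Finset ι) (x : ι → ℝ)
    (h0 : ∀ i ∈ s, 0 ≤ x i) (h1 : ∀ i ∈ s, x i ≤ 1) :
    1 - ∑ i ∈ s, x i ≤ ∏ i ∈ s, (1 - x i) := by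
  induction s using Finset.induction_on with
  | empty => simp
  | insert a s ha ih =>
    rw [Finset.sum_insert ha, Finset.prod_insert ha]
    have h0s : ∀ i ∈ s, 0 ≤ x i := fun i hi => h0 i (Finset.mem_insert_of_mem hi)
    have h1s : ∀ i ∈ s, x i ≤ 1 := fun i hi => h1 i (Finset.mem_insert_of_mem hi)
    have hih := ih h0s h1s
    have ha0 : 0 ≤ x a := h0 a (Finset.mem_insert_self a s)
    have ha1 : x a ≤ 1 := h1 a (Finset.mem_insert_self a s)
    have hsum : 0 ≤ ∑ i ∈ s, x i := Finset.sum_nonneg h0s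
    have hstep : (1 - x a) * (1 - ∑ i ∈ s, x i) ≤ (1 - x a) * ∏ i ∈ s, (1 - x i) :=
      mul_le_mul_of_nonneg_left hih (by linarith)
    nlinarith [hstep, mul_nonneg ha0 hsum]

/-- `Σ_{2 ≤ n ≤ N} 1/(n(n+1)) = 1/2 − 1/(N+1)` (telescoping), for `1 ≤ N`. [folklore] -/
private theorem sum_Icc_inv_mul_succ (N : ℕ) (hN : 1 ≤ N) :
    ∑ n ∈ Icc 2 N, ((n : ℝ) * (n + 1))⁻¹ = 1 / 2 - 1 / (N + 1) := by
  induction N, hN using Nat.le_induction with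
  | base => norm_num
  | succ N hN ih =>
    rw [Finset.sum_Icc_succ_top (by omega), ih]
    push_cast
    have h1 : (N : ℝ) + 1 ≠ 0 := by positivity
    have h2 : (N : ℝ) + 1 + 1 ≠ 0 := by positivity
    field_simp
    ring

/-- For any finite set of primes, `Σ_{p ∈ S} 1/(p(p+1)) ≤ 1/2`. [folklore] -/
private theorem sum_primes_inv_mul_succ_le_half (S : Finset Nat.Primes) :
    ∑ p ∈ S, (((p : ℕ) : ℝ) * ((p : ℕ) + 1))⁻¹ ≤ 1 / 2 := by
  classical
  set T : Finset ℕ := S.map ⟨((↑) : Nat.Primes → ℕ), Nat.Primes.coe_nat_injective⟩ with hT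
  have hST : ∑ p ∈ S, (((p : ℕ) : ℝ) * ((p : ℕ) + 1))⁻¹ = ∑ n ∈ T, ((n : ℝ) * (n + 1))⁻¹ := by
    rw [hT, Finset.sum_map]
    rfl
  rw [hST]
  set N := T.sup id ⊔ 1 with hN
  have hsub : T ⊆ Icc 2 N := by
    intro n hn
    rw [Finset.mem_Icc]
    refine ⟨?_, le_trans (Finset.le_sup (f := id) hn) le_sup_left⟩
    rw [hT, Finset.mem_map] at hn
    obtain ⟨p, _, rfl⟩ := hn
    exact p.prop.two_le
  calc ∑ n ∈ T, ((n : ℝ) * (n + 1))⁻¹ ≤ ∑ n ∈ Icc 2 N, ((n : ℝ) * (n + 1))⁻¹ :=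
        Finset.sum_le_sum_of_subset_of_nonneg hsub (fun n _ _ => by positivity)
    _ = 1 / 2 - 1 / (N + 1) := sum_Icc_inv_mul_succ N le_sup_right
    _ ≤ 1 / 2 := by
        have : (0 : ℝ) ≤ 1 / (N + 1) := by positivity
        linarith

/-- The Euler product converges (as a `HasProd`) to the series: `Π_p (1 − 1/(p²ψ(p)))` HAS product
`Σ_{m ≥ 1} μ(m) ψ(m)⁻¹ m⁻²`. [cite: KowalskiMichelVanderKam2000, (8)–(9); Euler product folklore] -/
theorem hasProd_one_sub_inv_sq_mul_psi :
    HasProd (fun p : Nat.Primes => 1 - (((p : ℕ) : ℝ) ^ 2 * psi p)⁻¹)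
      (∑' m : ℕ, (μ m : ℝ) * (psi m)⁻¹ / (m : ℝ) ^ 2) := by
  have hsum : Summable (fun m => ‖((μ : ArithmeticFunction ℝ).pmul
      (prodPrimeFactors fun p => ((p : ℝ) ^ 2 * (1 + (p : ℝ)⁻¹))⁻¹)) m‖) := by
    simp_rw [Real.norm_eq_abs, ← moebius_mul_inv_psi_div_sq_eq_pmul]
    exact summable_abs_moebius_mul_inv_psi_div_sq
  have hE := isMultiplicative_weight.eulerProduct_hasProd hsum
  simp_rw [← moebius_mul_inv_psi_div_sq_eq_pmul] at hE
  exact hE.congr_fun (fun p => (tsum_weight_prime_pow p.prop).symm)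

/-- **The model-(A) row constant is at least `1/2`**:
`Σ_{m ≥ 1} μ(m) ψ(m)⁻¹ m⁻² = Π_p (1 − 1/(p(p+1))) ≥ 1 − Σ_p 1/(p(p+1)) ≥ 1/2` (Weierstrass'
inequality on the partial products and `Σ_{n ≥ 2} 1/(n(n+1)) = 1/2`). In particular the
leading-order
row `c·Φ(1)` of the card has `c = ζ(2)·Π_p(1 − 1/(p(p+1))) > 0`, so the Siegel-point constraint
under model (A) is exactly `Φ(1) = 0`. [cite: KowalskiMichelVanderKam2000, (8)–(9) (the weights);
the bound is elementary] -/
theorem half_le_tsum_moebius_mul_inv_psi_div_sq :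
    1 / 2 ≤ ∑' m : ℕ, (μ m : ℝ) * (psi m)⁻¹ / (m : ℝ) ^ 2 := by
  have hP := hasProd_one_sub_inv_sq_mul_psi
  rw [HasProd] at hP
  refine ge_of_tendsto' hP (fun S => ?_)
  have hx0 : ∀ p ∈ S, (0 : ℝ) ≤ (((p : ℕ) : ℝ) ^ 2 * psi p)⁻¹ := fun p _ =>
    inv_nonneg.mpr (mul_nonneg (by positivity) (le_trans zero_le_one (one_le_psi _)))
  have hx1 : ∀ p ∈ S, (((p : ℕ) : ℝ) ^ 2 * psi p)⁻¹ ≤ 1 := by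
    intro p _
    have hp2 : (2 : ℝ) ≤ (p : ℕ) := by exact_mod_cast p.prop.two_le
    have h1 : (1 : ℝ) ≤ ((p : ℕ) : ℝ) ^ 2 * psi p :=
      one_le_mul_of_one_le_of_one_le (by nlinarith) (one_le_psi _)
    exact inv_le_one_of_one_le₀ h1
  refine le_trans ?_ (one_sub_sum_le_prod_one_sub S _ hx0 hx1)
  have hS := sum_primes_inv_mul_succ_le_half S
  have heq : ∑ p ∈ S, (((p : ℕ) : ℝ) ^ 2 * psi p)⁻¹ =
      ∑ p ∈ S, (((p : ℕ) : ℝ) * ((p : ℕ) + 1))⁻¹ := by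
    refine Finset.sum_congr rfl (fun p _ => ?_)
    have h := one_sub_inv_sq_mul_psi p.prop
    linarith
  rw [heq]
  linarith

/-- **The model-(A) row constant is positive**: `0 < Π_p (1 − 1/(p² ψ(p)))`.
[cite: KowalskiMichelVanderKam2000, (8)–(9) (the weights); elementary] -/
theorem tprod_one_sub_inv_sq_mul_psi_pos :
    0 < ∏' p : Nat.Primes, (1 - (((p : ℕ) : ℝ) ^ 2 * psi p)⁻¹) := by
  rw [← tsum_moebius_mul_inv_psi_div_sq_eq_tprod]
  linarith [half_le_tsum_moebius_mul_inv_psi_div_sq]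

end Literature.NumberTheory.LFunctions.KMV2000

end
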